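/-
Copyright (c) 2026 the pub-hodgecm-mathlib formalisation cell (harness21).  Prover seat hodgecm-mathlib-F0P3-p01 (g36), Track A «(D-RAM) FOUR-FRAME» squad, helper lane on
h413 = stmt-HodgeConjecture-24833 (count-neutral).  Dealer∕pen LH4-plan (g13) WORD #88 «(β-BAL) B2b-1 = F0P3-p01»; LH4-p11 (g8) SPEC-B2 v1 3227ed60 §3 (B2b-1).  2026-09-04.
-/
import Summits.HodgeConjecture.HodgeConjecture.Theorems.F0P3cDyRamLabelledOddCountDefs          -- ★ p860257 DEFS leaf (LH4-p11 (g8)): `labelledOddCount`, `classLabelSign`, `polarisationNormClasses`, `valueClassLabel`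
import Summits.HodgeConjecture.HodgeConjecture.Theorems.F0P3cDyRamDiagonalLabelledOddOrbitCount   -- ★ p860280 (B2a-3): `relIndex_map_unitNormMap_unitStabilizer_ne_zero`; brings ★ OrbitFibreTransport (`fibre_isCoset_zero`), ★ OrbitAveraging, ★ TorusDefs
import Summits.HodgeConjecture.HodgeConjecture.Theorems.F0P3cDyRamDiagonalKappaCountEval          -- ★ (LH4-p05 (g3)): `normSign_mul_of_dichotomy`; brings ★ `normSign_mul_norm`, ★ `normSign_eq_one_or`
import Literature.NumberTheory.Automorphic.UnitaryLatticeTreeCentralRescalingCountTransport       -- ★ `mapGL_eq_of_coe_eq_smul` (a unit homothety fixes every lattice: the scalar stabilisers)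
import Mathlib.RingTheory.IntegralDomain                                                          -- `sum_hom_units` (character sums over a finite group)
import HarnessLib

/-!
# Crux `H413`, line LH4 «(D-RAM) FOUR-FRAME» — (β-BAL) B2b-1 «THE ONE-SLOT-DOMINANT ORBIT LABEL READ»: on a one-slot-dominant orbit the value-class label of record reads
# `Λ(M₀, D₁·u) = [ε·ω(u_k) = 1]`; PART 1: the labelled odd count of a ONE-SLOT LABEL is `m^Λ_i(M₀) = ε·ω(D_{1,i})·|A|∕2·[ω_iω_k ≡ 1 on S_F(M₀)]`

Cell `hodgecm-mathlib` (D-0151), FLOOR 0, crux item H413 = `stmt-HodgeConjecture-24833`, route `HCCMUnconditional`; squad F0∕P3c∕LH4.  THEOREMS ONLY (no `def`, no instance, no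
notation, no `sorry`, default heartbeats); ★-only imports; lane `--supports stmt-HodgeConjecture-24833 --as helper` (count-neutral); pays NO row, states NO law.

THE MATHEMATICS (SPEC-B2 v1 §3 (B2b-1), in the currency of the ★ DEFS leaf «LabelledOddCountDefs»).  Data: `σ` an isometric involution, a `σ`-fixed non-norm `c` with the
index-two dichotomy (so `ω = normSign σ` is multiplicative on the non-zero fixed scalars, ★ `normSign_mul_of_dichotomy`), a lattice `M₀` whose type-`tv` polarisations form ONE
`S_F(M₀)`-coset `D₁·S_F(M₀)` (the `hcoset` shape of ★ (O2b) ∕ SIG (B2a-2); at `tv = 0` on every normalised `latt g` by ★ `fibre_isCoset_zero`).  Write `S_F = fixedUnitStabilizer σ M₀`,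
`N′ = N(S̃′(M₀)) = (unitStabilizer M₀).map (unitNormMap σ 3)` (`≤ S_F`, §1) and `A = S_F ∕ N′`, `|A| = N′.relIndex S_F`.
* §1  `N′ ≤ S_F` (★ (O2b) Step 1 as a lemma); `ω` does not see `N′`; the scalar stabilisers `(a,a,a)`, `a ∈ 𝒪_F^×`, lie in `S_F`.
* §2  THE CLASSES.  `polarisationNormClasses σ ϖ tv M₀ = {cl u | u ∈ S_F}`, `cl u := D₁·u·N′`, and `cl u = cl u′ ↔ u⁻¹u′ ∈ N′`: the classes are in bijection with the finite
  quotient `S_F ∕ N′` (finite: `|A| ≠ 0`).  A ONE-SLOT LABEL is a label with `Λ M₀ (D₁·u) ↔ ε·ω(u_k) = 1` on `S_F` (`ε = ±1`, slot `k`); on `cl u` both `Λ M₀` and `ω(·_i)` are then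
  constant, so `classLabelSign σ i (Λ M₀) (cl u) = [ε·ω(u_k) = 1]·ω(D_{1,i})·ω(u_i)`.
* §3  HEAD A `two_mul_labelledOddCount_eq_of_oneSlot`: summing over `A` with `[ε·ω(u_k) = 1] = (1 + ε·ω(u_k))∕2` and the character sums `Σ_A ω_i`, `Σ_A ω_iω_k` (Mathlib
  `sum_hom_units` on the homomorphisms `S_F ∕ N′ →* ℤ`): `2·m^Λ_i(M₀) = ω(D_{1,i})·|A|·([ω_i ≡ 1 on S_F] + ε·[ω_iω_k ≡ 1 on S_F])`.  With a UNIT non-norm `c` the scalar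
  stabiliser `(c,c,c) ∈ S_F` kills the first indicator (`…_of_unit`): `2·m^Λ_i = ε·ω(D_{1,i})·|A|·[ω_iω_k ≡ 1 on S_F]` — at `i = k`, `ε·ω(D_{1,k})·|A|`, «the same sign for every
  such orbit»; over `ℚ` (HEAD A′, finite orbit, `[𝒰 : N′] = |A|·[𝒰 : S_F]`): `m^Λ_i(M₀) ∕ [𝒰 : N′] = ε·ω(D_{1,i})∕2 · [ω_iω_k ≡ 1 on S_F] · stabiliserWeight σ M₀` — the per-orbit
  term of the labelled Stage A (★ p860280 ∕ (A_L)) there: HALF A κ-TERM for the pair `(i, k)`.  SEQUEL `…LabelledOddOneSlotValueClass` (HEAD B∕C): the value-class label of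
  record on a one-slot-dominant normalised `latt A` IS a one-slot label with `ε = ω(e′)` (★ (L-lab-11) + ★ (L-lab-3)); the per-orbit term of ★ (A_L) p860336 there.
HONEST LABEL.  Count-neutral; proves no census ((β-BAL)∕(A″)∕(β)∕T₊ OPEN); `HC_CM` is proved only modulo the 7 printed citations (hLiu418 = 24832, h413 = 24833) until rung 0 closes.

## References
* [Kottwitz1986BaseChangeUnits] R. E. Kottwitz, *Base change for unit elements of Hecke algebras*, Compositio Math. 60 (1986), §1 pp. 240–241 (signed lattice counts; stabiliser indices).
* [Rogawski1990] J. D. Rogawski, *Automorphic Representations of Unitary Groups in Three Variables*, Ann. of Math. Stud. 123 (1990), §4.9 Prop. 4.9.1 (a)(b) p. 55, §4.10 p. 58.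
* [LanglandsShelstad1987] R. P. Langlands, D. Shelstad, *On the definition of transfer factors*, Math. Ann. 278 (1987), §3 (the characters of `H¹(F, T) = (ℤ∕2)³`).
* [Serre1979] J.-P. Serre, *Local Fields*, GTM 67 (1979), Ch. V §3 Cor. 3 (`[U_F : N U_E] = 2`; norm classes of units), Ch. VI §1 (orthogonality of characters of a finite abelian group).
-/

set_option autoImplicit false

noncomputable section

namespace Summit.HodgeConjecture.HodgeConjecture.Cruxes.H413.F0P3cDyRamLabelledOddOneSlotRead

open Literature.NumberTheory.Automorphic Literature.NumberTheory.Automorphic.HermitianLattice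
open Literature.NumberTheory.Automorphic.UnitaryLatticeTree Literature.NumberTheory.Automorphic.UnitaryThreeFourFrame
open Summit.HodgeConjecture.HodgeConjecture.Cruxes.H413.F0P3cDyRamFourFramePieces
open Summit.HodgeConjecture.HodgeConjecture.Cruxes.H413.F0P3cDyRamDiagonalTorusDefs
open Summit.HodgeConjecture.HodgeConjecture.Cruxes.H413.F0P3cDyRamLabelledOddCountDefs
open Summit.HodgeConjecture.HodgeConjecture.Cruxes.H413.F0P3cDyRamDiagonalOrbitFibreTransport
open Summit.HodgeConjecture.HodgeConjecture.Cruxes.H413.F0P3cDyRamDiagonalOrbitAveraging (relIndex_fixedUnitStabilizer_ne_zero_of_finite)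
open Summit.HodgeConjecture.HodgeConjecture.Cruxes.H413.F0P3cDyRamDiagonalLabelledOddOrbitCount (relIndex_map_unitNormMap_unitStabilizer_ne_zero)
open Summit.HodgeConjecture.HodgeConjecture.Cruxes.H413.F0P3cDyRamDiagonalKappaCountEval (normSign_mul_of_dichotomy fixed_of_mem_fixedUnitStabilizer)
open Summit.HodgeConjecture.HodgeConjecture.Cruxes.H413.F0P3cDyRamFixedCountDiagonalModel (normSign_mul_norm)
open Summit.HodgeConjecture.HodgeConjecture.Cruxes.H413.F0P3cDyRamStableSumSignClasses (normSign_eq_one_or)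
open scoped Valued WithZero Matrix MatrixGroups

variable {K : Type} [Field K] [Valued K ℤᵐ⁰]

/-! ## §1  `N(S̃′(M₀)) ≤ S_F(M₀)`; `ω` does not see `N(S̃′)`; the scalar stabilisers -/

/-- **`N(S̃′(M₀)) ≤ S_F(M₀)`** (★ (O2b) Step 1, as a lemma): if the type-`tv` polarisations of `M₀` form the coset `D₁·S_F(M₀)`, then for a unit diagonal stabiliser `s` of `M₀`
the vector `N(s) = s·σs` is a `σ`-fixed unit stabiliser (★ `isVertexLattice_diagonal_mapGL_diagGLUnits_iff` + `hcoset`). [cite: Kottwitz1986BaseChangeUnits, §1 pp. 240–241] -/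
theorem map_unitNormMap_unitStabilizer_le (σ : K →+* K) (hσ : ∀ x, σ (σ x) = x) (ϖ : K) (tv : ℕ) {M₀ : Submodule 𝒪[K] (Fin 3 → K)}
    {D₁ : Fin 3 → K} (hD₁ : ∀ j, σ (D₁ j) = D₁ j ∧ D₁ j ≠ 0) (hV₁ : IsVertexLattice σ ϖ (Matrix.diagonal D₁) tv M₀)
    (hcoset : ∀ D : Fin 3 → K, (∀ j, σ (D j) = D j ∧ D j ≠ 0) →
      (IsVertexLattice σ ϖ (Matrix.diagonal D) tv M₀ ↔ ∃ u ∈ fixedUnitStabilizer σ M₀, ∀ j, D j = D₁ j * ((u j : Kˣ) : K))) :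
    (unitStabilizer M₀).map (unitNormMap σ 3) ≤ fixedUnitStabilizer σ M₀ := by
  rintro _ ⟨s, hs, rfl⟩
  have hsS : mapGL (diagGLUnits s) M₀ = M₀ := ((mem_unitStabilizer_iff M₀ s).1 hs).1
  have hV' : IsVertexLattice σ ϖ (Matrix.diagonal D₁) tv (mapGL (diagGLUnits s) M₀) := by rw [hsS]; exact hV₁
  rw [isVertexLattice_diagonal_mapGL_diagGLUnits_iff] at hV'
  have hDfix : ∀ j, σ (D₁ j * (((s j : Kˣ) : K) * σ ((s j : Kˣ) : K))) = D₁ j * (((s j : Kˣ) : K) * σ ((s j : Kˣ) : K)) ∧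
      D₁ j * (((s j : Kˣ) : K) * σ ((s j : Kˣ) : K)) ≠ 0 := fun j =>
    ⟨by rw [map_mul, map_mul, (hD₁ j).1, hσ, mul_comm (σ ((s j : Kˣ) : K))],
      mul_ne_zero (hD₁ j).2 (mul_ne_zero (s j).ne_zero ((map_ne_zero σ).2 (s j).ne_zero))⟩
  obtain ⟨u, huSF, hu⟩ := (hcoset _ hDfix).1 hV'
  have heq : unitNormMap σ 3 s = u := funext fun j => Units.ext (by
    rw [unitNormMap_apply]; exact mul_left_cancel₀ (hD₁ j).2 (hu j))
  rw [heq]; exact huSF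

/-- **`ω` DOES NOT SEE `N(S̃′)`**: `ω(x·n_j) = ω(x)` for `n ∈ N(S̃′(M₀))` (`n_j = s_j·σs_j` is a norm, ★ `normSign_mul_norm`). [cite: Serre1979, Ch. V §3 Cor. 3] -/
theorem normSign_mul_eq_of_mem_map_unitNormMap (σ : K →+* K) {M₀ : Submodule 𝒪[K] (Fin 3 → K)} {n : Fin 3 → Kˣ}
    (hn : n ∈ (unitStabilizer M₀).map (unitNormMap σ 3)) (x : K) (j : Fin 3) : normSign σ (x * ((n j : Kˣ) : K)) = normSign σ x := by
  obtain ⟨s, -, rfl⟩ := hn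
  rw [unitNormMap_apply]
  exact normSign_mul_norm σ x (s j).ne_zero

/-- **THE SCALAR STABILISERS**: for a `σ`-fixed unit `a`, the constant vector `(a, a, a)` lies in `S_F(M₀)` for EVERY `𝒪`-submodule `M₀` (a unit homothety fixes every lattice, ★
`mapGL_eq_of_coe_eq_smul`). [cite: Kottwitz1986BaseChangeUnits, §1 pp. 240–241] -/
theorem const_mem_fixedUnitStabilizer (σ : K →+* K) (M₀ : Submodule 𝒪[K] (Fin 3 → K)) {a : Kˣ} (hσa : σ (a : K) = a) (ha : Valued.v (a : K) = 1) :
    (fun _ : Fin 3 => a) ∈ fixedUnitStabilizer σ M₀ := by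
  rw [mem_fixedUnitStabilizer_iff]
  refine ⟨?_, fun _ => ha, fun _ => hσa⟩
  have hTT : ((diagGLUnits (fun _ : Fin 3 => a) : GL (Fin 3) K) : Matrix (Fin 3) (Fin 3) K) = (a : K) • ((1 : GL (Fin 3) K) : Matrix (Fin 3) (Fin 3) K) := by
    rw [coe_diagGLUnits, Units.val_one, ← Matrix.diagonal_one, ← Matrix.diagonal_smul]
    congr 1; funext i; rw [Pi.smul_apply, smul_eq_mul, mul_one]
  rw [mapGL_eq_of_coe_eq_smul ha hTT M₀, mapGL_one]

/-- With a `σ`-fixed UNIT non-norm `c` available, `ω(·_i)` is NOT identically `1` on `S_F(M₀)` (test the scalar stabiliser `(c, c, c)`). [cite: Serre1979, Ch. V §3 Cor. 3] -/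
theorem not_forall_normSign_apply_eq_one (σ : K →+* K) (M₀ : Submodule 𝒪[K] (Fin 3 → K)) {c : K} (hσc : σ c = c) (hcv : Valued.v c = 1)
    (hc : ¬ ∃ z : K, z * σ z = c) (i : Fin 3) : ¬ ∀ u ∈ fixedUnitStabilizer σ M₀, normSign σ ((u i : Kˣ) : K) = 1 := by
  have hc0 : c ≠ 0 := fun h => by rw [h, map_zero] at hcv; exact zero_ne_one hcv
  intro h
  have h1 := h (fun _ : Fin 3 => Units.mk0 c hc0) (const_mem_fixedUnitStabilizer σ M₀ (a := Units.mk0 c hc0) hσc hcv)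
  rw [Units.val_mk0] at h1
  unfold normSign at h1
  rw [if_neg hc] at h1
  exact absurd h1 (by decide)

/-! ## §2  The classes of a one-coset fibre and the signed label of a class under a one-slot label -/

section Classes

variable {σ : K →+* K} {ϖ : K} {tv : ℕ} {M₀ : Submodule 𝒪[K] (Fin 3 → K)} {D₁ : Fin 3 → K}

/-- **`cl u = cl u′ ↔ u⁻¹u′ ∈ N′`** (`D₁` non-degenerate). [cite: Kottwitz1986BaseChangeUnits, §1 pp. 240–241] -/
theorem cl_eq_cl_iff (hD₁ : ∀ j, σ (D₁ j) = D₁ j ∧ D₁ j ≠ 0) (u u' : Fin 3 → Kˣ) :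
    {D' : Fin 3 → K | ∃ n ∈ (unitStabilizer M₀).map (unitNormMap σ 3), ∀ j, D' j = D₁ j * ((u j : Kˣ) : K) * ((n j : Kˣ) : K)} =
        {D' : Fin 3 → K | ∃ n ∈ (unitStabilizer M₀).map (unitNormMap σ 3), ∀ j, D' j = D₁ j * ((u' j : Kˣ) : K) * ((n j : Kˣ) : K)} ↔
      u⁻¹ * u' ∈ (unitStabilizer M₀).map (unitNormMap σ 3) := by
  set N' := (unitStabilizer M₀).map (unitNormMap σ 3)
  constructor
  · intro h
    have hmem : (fun j => D₁ j * ((u' j : Kˣ) : K)) ∈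
        {D' : Fin 3 → K | ∃ n ∈ N', ∀ j, D' j = D₁ j * ((u' j : Kˣ) : K) * ((n j : Kˣ) : K)} := ⟨1, one_mem _, fun j => by simp⟩
    rw [← h] at hmem
    obtain ⟨n, hn, hDn⟩ := hmem
    have heq : u⁻¹ * u' = n := funext fun j => Units.ext (by
      have h1 : ((u' j : Kˣ) : K) = ((u j : Kˣ) : K) * ((n j : Kˣ) : K) := by
        have := hDn j; rw [mul_assoc] at this; exact mul_left_cancel₀ (hD₁ j).2 this
      rw [Pi.mul_apply, Pi.inv_apply, Units.val_mul, Units.val_inv_eq_inv_val, h1, inv_mul_cancel_left₀ (u j).ne_zero])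
    rw [heq]; exact hn
  · intro h
    ext D'
    simp only [Set.mem_setOf_eq]
    constructor
    · rintro ⟨n, hn, hDn⟩
      refine ⟨(u⁻¹ * u')⁻¹ * n, mul_mem (inv_mem h) hn, fun j => ?_⟩
      rw [hDn j]
      simp only [Pi.mul_apply, Pi.inv_apply, Units.val_mul, Units.val_inv_eq_inv_val, mul_inv_rev, inv_inv]
      field_simp
    · rintro ⟨n, hn, hDn⟩
      refine ⟨(u⁻¹ * u') * n, mul_mem h hn, fun j => ?_⟩
      rw [hDn j]
      simp only [Pi.mul_apply, Pi.inv_apply, Units.val_mul, Units.val_inv_eq_inv_val]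
      field_simp

/-- **THE CLASSES ARE THE `cl u`, `u ∈ S_F`** (one-coset fibre). [cite: Kottwitz1986BaseChangeUnits, §1 pp. 240–241] -/
theorem mem_polarisationNormClasses_iff_exists_cl (hD₁ : ∀ j, σ (D₁ j) = D₁ j ∧ D₁ j ≠ 0)
    (hcoset : ∀ D : Fin 3 → K, (∀ j, σ (D j) = D j ∧ D j ≠ 0) →
      (IsVertexLattice σ ϖ (Matrix.diagonal D) tv M₀ ↔ ∃ u ∈ fixedUnitStabilizer σ M₀, ∀ j, D j = D₁ j * ((u j : Kˣ) : K)))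
    (C : Set (Fin 3 → K)) :
    C ∈ polarisationNormClasses σ ϖ tv M₀ ↔ ∃ u ∈ fixedUnitStabilizer σ M₀,
      C = {D' : Fin 3 → K | ∃ n ∈ (unitStabilizer M₀).map (unitNormMap σ 3), ∀ j, D' j = D₁ j * ((u j : Kˣ) : K) * ((n j : Kˣ) : K)} := by
  rw [mem_polarisationNormClasses_iff]
  constructor
  · rintro ⟨D, ⟨hD, hV⟩, rfl⟩
    obtain ⟨u, hu, hDu⟩ := (hcoset D hD).1 hV
    refine ⟨u, hu, ?_⟩
    ext D'
    simp only [Set.mem_setOf_eq, hDu]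
  · rintro ⟨u, hu, rfl⟩
    have hfix := fixed_of_mem_fixedUnitStabilizer σ hu
    have hD : ∀ j, σ (D₁ j * ((u j : Kˣ) : K)) = D₁ j * ((u j : Kˣ) : K) ∧ D₁ j * ((u j : Kˣ) : K) ≠ 0 := fun j =>
      ⟨by rw [map_mul, (hD₁ j).1, (hfix j).1], mul_ne_zero (hD₁ j).2 (hfix j).2⟩
    refine ⟨fun j => D₁ j * ((u j : Kˣ) : K), ⟨hD, (hcoset _ hD).2 ⟨u, hu, fun j => rfl⟩⟩, ?_⟩
    ext D'
    simp only [Set.mem_setOf_eq]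

/-- **THE SIGNED LABEL OF A CLASS UNDER A ONE-SLOT LABEL**: if `Λ M₀ (D₁·u) ↔ ε·ω(u_k) = 1` on `S_F(M₀)` (and `N′ ≤ S_F`), then on `cl u` both `Λ M₀` and `ω(·_i)` are constant and
`classLabelSign σ i (Λ M₀) (cl u) = if ε·ω(u_k) = 1 then ω(D_{1,i})·ω(u_i) else 0`. [cite: Kottwitz1986BaseChangeUnits, §1 pp. 240–241] [cite: LanglandsShelstad1987, §3] -/
theorem classLabelSign_cl_eq {c : K} (hσc : σ c = c) (hc : ¬ ∃ z : K, z * σ z = c)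
    (hdich : ∀ x : K, σ x = x → x ≠ 0 → (∃ z : K, z * σ z = x) ∨ ∃ z : K, z * σ z = c * x)
    (hD₁ : ∀ j, σ (D₁ j) = D₁ j ∧ D₁ j ≠ 0) (hNS : (unitStabilizer M₀).map (unitNormMap σ 3) ≤ fixedUnitStabilizer σ M₀)
    (Λ : Submodule 𝒪[K] (Fin 3 → K) → (Fin 3 → K) → Prop) (i k : Fin 3) (ε : ℤ)
    (hΛ : ∀ u ∈ fixedUnitStabilizer σ M₀, Λ M₀ (fun j => D₁ j * ((u j : Kˣ) : K)) ↔ ε * normSign σ ((u k : Kˣ) : K) = 1)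
    {u : Fin 3 → Kˣ} (hu : u ∈ fixedUnitStabilizer σ M₀) :
    classLabelSign σ i (Λ M₀) {D' : Fin 3 → K | ∃ n ∈ (unitStabilizer M₀).map (unitNormMap σ 3), ∀ j, D' j = D₁ j * ((u j : Kˣ) : K) * ((n j : Kˣ) : K)} =
      if ε * normSign σ ((u k : Kˣ) : K) = 1 then normSign σ (D₁ i) * normSign σ ((u i : Kˣ) : K) else 0 := by
  classical
  set C := {D' : Fin 3 → K | ∃ n ∈ (unitStabilizer M₀).map (unitNormMap σ 3), ∀ j, D' j = D₁ j * ((u j : Kˣ) : K) * ((n j : Kˣ) : K)} with hC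
  have hfixu := fixed_of_mem_fixedUnitStabilizer σ hu
  have hmem : (fun j => D₁ j * ((u j : Kˣ) : K)) ∈ C := ⟨1, one_mem _, fun j => by simp⟩
  -- on `C`, `Λ M₀` is constant `= [ε·ω(u_k) = 1]` and `ω(·_i)` is constant `= ω(D₁ i)·ω(u_i)`
  have hconst : ∀ D' ∈ C, (Λ M₀ D' ↔ ε * normSign σ ((u k : Kˣ) : K) = 1) ∧ normSign σ (D' i) = normSign σ (D₁ i) * normSign σ ((u i : Kˣ) : K) := by
    rintro D' ⟨n, hn, hDn⟩
    obtain ⟨n', hn', rfl⟩ : ∃ n' ∈ unitStabilizer M₀, unitNormMap σ 3 n' = n := hn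
    have hmemN : unitNormMap σ 3 n' ∈ (unitStabilizer M₀).map (unitNormMap σ 3) := ⟨n', hn', rfl⟩
    have hun : u * unitNormMap σ 3 n' ∈ fixedUnitStabilizer σ M₀ := mul_mem hu (hNS hmemN)
    have hD'eq : D' = fun j => D₁ j * (((u * unitNormMap σ 3 n') j : Kˣ) : K) := funext fun j => by
      rw [hDn j, Pi.mul_apply, Units.val_mul, mul_assoc]
    refine ⟨?_, ?_⟩
    · rw [hD'eq, hΛ _ hun, Pi.mul_apply, Units.val_mul, normSign_mul_eq_of_mem_map_unitNormMap σ hmemN]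
    · rw [hDn i, normSign_mul_eq_of_mem_map_unitNormMap σ hmemN,
        normSign_mul_of_dichotomy σ hσc hc hdich (hD₁ i).1 (hfixu i).1 (hD₁ i).2 (hfixu i).2]
  split_ifs with halive
  · rcases normSign_eq_one_or σ (D₁ i * ((u i : Kˣ) : K)) with h1 | h1 <;>
      rw [normSign_mul_of_dichotomy σ hσc hc hdich (hD₁ i).1 (hfixu i).1 (hD₁ i).2 (hfixu i).2] at h1 <;> rw [h1]
    · exact classLabelSign_eq_one_of_forall σ i (Λ M₀) fun D' hD' => ⟨(hconst D' hD').1.2 halive, (hconst D' hD').2.trans h1⟩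
    · exact classLabelSign_eq_neg_one_of_forall σ i (Λ M₀) ⟨_, hmem⟩ fun D' hD' => ⟨(hconst D' hD').1.2 halive, (hconst D' hD').2.trans h1⟩
  · exact classLabelSign_eq_zero_of_not σ i (Λ M₀) hmem fun hP => halive ((hconst _ hmem).1.1 hP)

end Classes

/-! ## §3  HEAD A — the labelled odd count of a ONE-SLOT label (generic `Λ`) -/

section HeadA

variable {σ : K →+* K} {ϖ : K} {tv : ℕ} {M₀ : Submodule 𝒪[K] (Fin 3 → K)} {D₁ : Fin 3 → K}

omit [Valued K ℤᵐ⁰] in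
/-- `ω(1) = 1`. [cite: Serre1979, Ch. V §3 Cor. 3] -/
theorem normSign_one_eq (σ : K →+* K) : normSign σ (1 : K) = 1 := by
  unfold normSign; exact if_pos ⟨1, by rw [map_one, mul_one]⟩

/-- Pointwise bookkeeping: for `a, b, ε ∈ {±1}`, `2·[ε·a = 1]·(s·b) = s·(b + ε·(b·a))`. [cite: LanglandsShelstad1987, §3] -/
theorem two_mul_ite_eq {ε a : ℤ} (hε : ε = 1 ∨ ε = -1) (ha : a = 1 ∨ a = -1) (s b : ℤ) :
    2 * (if ε * a = 1 then s * b else 0) = s * (b + ε * (b * a)) := by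
  rcases hε with rfl | rfl <;> rcases ha with rfl | rfl <;> norm_num <;> ring

open Classical in
/-- **HEAD A — THE LABELLED ODD COUNT OF A ONE-SLOT LABEL.**  Let the type-`tv` polarisations of `M₀` form the coset `D₁·S_F(M₀)` (`hcoset`), `|A| := [S_F(M₀) : N(S̃′(M₀))] ≠ 0`,
and let `Λ M₀ (D₁·u) ↔ ε·ω(u_k) = 1` on `S_F(M₀)` (`ε = ±1`).  Then
`2 · labelledOddCount σ ϖ tv i Λ M₀ = ω(D_{1,i}) · |A| · ([∀ u ∈ S_F, ω(u_i) = 1] + ε · [∀ u ∈ S_F, ω(u_i)·ω(u_k) = 1])`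
(classes ≃ `S_F ∕ N(S̃′)`; signed label of a class `= [ε·ω(u_k) = 1]·ω(D_{1,i})ω(u_i)`; `[ε·a = 1] = (1 + ε·a)∕2`; character sums over `A` by Mathlib `sum_hom_units`).
[cite: Kottwitz1986BaseChangeUnits, §1 pp. 240–241] [cite: LanglandsShelstad1987, §3] [cite: Serre1979, Ch. VI §1] -/
theorem two_mul_labelledOddCount_eq_of_oneSlot (hσ : ∀ x, σ (σ x) = x)
    {c : K} (hσc : σ c = c) (hc : ¬ ∃ z : K, z * σ z = c)
    (hdich : ∀ x : K, σ x = x → x ≠ 0 → (∃ z : K, z * σ z = x) ∨ ∃ z : K, z * σ z = c * x)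
    (hD₁ : ∀ j, σ (D₁ j) = D₁ j ∧ D₁ j ≠ 0) (hV₁ : IsVertexLattice σ ϖ (Matrix.diagonal D₁) tv M₀)
    (hcoset : ∀ D : Fin 3 → K, (∀ j, σ (D j) = D j ∧ D j ≠ 0) →
      (IsVertexLattice σ ϖ (Matrix.diagonal D) tv M₀ ↔ ∃ u ∈ fixedUnitStabilizer σ M₀, ∀ j, D j = D₁ j * ((u j : Kˣ) : K)))
    (hA : ((unitStabilizer M₀).map (unitNormMap σ 3)).relIndex (fixedUnitStabilizer σ M₀) ≠ 0)
    (Λ : Submodule 𝒪[K] (Fin 3 → K) → (Fin 3 → K) → Prop) (i k : Fin 3) {ε : ℤ} (hε : ε = 1 ∨ ε = -1)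
    (hΛ : ∀ u ∈ fixedUnitStabilizer σ M₀, Λ M₀ (fun j => D₁ j * ((u j : Kˣ) : K)) ↔ ε * normSign σ ((u k : Kˣ) : K) = 1) :
    2 * labelledOddCount σ ϖ tv i Λ M₀ =
      normSign σ (D₁ i) * ((((unitStabilizer M₀).map (unitNormMap σ 3)).relIndex (fixedUnitStabilizer σ M₀) : ℕ) : ℤ) *
        ((if ∀ u ∈ fixedUnitStabilizer σ M₀, normSign σ ((u i : Kˣ) : K) = 1 then 1 else 0) +
          ε * (if ∀ u ∈ fixedUnitStabilizer σ M₀, normSign σ ((u i : Kˣ) : K) * normSign σ ((u k : Kˣ) : K) = 1 then 1 else 0)) := by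
  set S := fixedUnitStabilizer σ M₀ with hSdef
  set N' := (unitStabilizer M₀).map (unitNormMap σ 3) with hN'def
  have hNS : N' ≤ S := map_unitNormMap_unitStabilizer_le σ hσ ϖ tv hD₁ hV₁ hcoset
  have hfixS : ∀ u : S, ∀ j, σ ((u.1 j : Kˣ) : K) = u.1 j ∧ ((u.1 j : Kˣ) : K) ≠ 0 := fun u => fixed_of_mem_fixedUnitStabilizer σ u.2
  -- the finite quotient `A = S_F ∕ N′`
  set H : Subgroup S := N'.subgroupOf S with hHdef
  have hHi : H.index = N'.relIndex S := rfl
  haveI : H.FiniteIndex := ⟨by rw [hHi]; exact hA⟩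
  letI : Fintype (S ⧸ H) := Fintype.ofFinite _
  have hcard : (Fintype.card (S ⧸ H) : ℤ) = ((N'.relIndex S : ℕ) : ℤ) := by
    rw [← Nat.card_eq_fintype_card, ← Subgroup.index_eq_card, hHi]
  -- the classes, indexed by `A`
  set cl : S → Set (Fin 3 → K) := fun u =>
    {D' : Fin 3 → K | ∃ n ∈ N', ∀ j, D' j = D₁ j * ((u.1 j : Kˣ) : K) * ((n j : Kˣ) : K)} with hcldef
  have hcl : ∀ u u' : S, cl u = cl u' ↔ u⁻¹ * u' ∈ H := fun u u' => by
    rw [Subgroup.mem_subgroupOf, Subgroup.coe_mul, Subgroup.coe_inv]; exact cl_eq_cl_iff hD₁ u.1 u'.1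
  let e : S ⧸ H → Set (Fin 3 → K) := Quotient.lift cl fun u u' huu' => (hcl u u').2 (QuotientGroup.leftRel_apply.1 huu')
  have he_mk : ∀ u : S, e (QuotientGroup.mk u) = cl u := fun u => rfl
  have hbij : Set.BijOn e Set.univ (polarisationNormClasses σ ϖ tv M₀) := by
    refine ⟨fun q _ => ?_, fun q _ q' _ hqq' => ?_, fun C hC => ?_⟩
    · induction q using QuotientGroup.induction_on with
      | H u => rw [he_mk]; exact (mem_polarisationNormClasses_iff_exists_cl hD₁ hcoset _).2 ⟨u.1, u.2, rfl⟩
    · induction q using QuotientGroup.induction_on with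
      | H u =>
        induction q' using QuotientGroup.induction_on with
        | H u' => rw [he_mk, he_mk] at hqq'; exact QuotientGroup.eq.2 ((hcl u u').1 hqq')
    · obtain ⟨u, hu, rfl⟩ := (mem_polarisationNormClasses_iff_exists_cl hD₁ hcoset C).1 hC
      exact ⟨QuotientGroup.mk ⟨u, hu⟩, Set.mem_univ _, rfl⟩
  have hsum : labelledOddCount σ ϖ tv i Λ M₀ = ∑ q : S ⧸ H, classLabelSign σ i (Λ M₀) (e q) := by
    rw [labelledOddCount_eq, ← finsum_mem_eq_of_bijOn (f := fun q => classLabelSign σ i (Λ M₀) (e q)) e hbij (fun _ _ => rfl),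
      finsum_mem_univ, finsum_eq_sum_of_fintype]
  -- the slot characters `ω_j : S_F →* ℤ` and their descent to `A`
  let χ : Fin 3 → (S →* ℤ) := fun j =>
    { toFun := fun u => normSign σ ((u.1 j : Kˣ) : K)
      map_one' := by
        show normSign σ ((((1 : S) : Fin 3 → Kˣ) j : Kˣ) : K) = 1
        rw [OneMemClass.coe_one, Pi.one_apply, Units.val_one]; exact normSign_one_eq σ
      map_mul' := fun u u' => by
        show normSign σ ((((u * u' : S) : Fin 3 → Kˣ) j : Kˣ) : K) = normSign σ ((u.1 j : Kˣ) : K) * normSign σ ((u'.1 j : Kˣ) : K)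
        rw [Subgroup.coe_mul, Pi.mul_apply, Units.val_mul]
        exact normSign_mul_of_dichotomy σ hσc hc hdich (hfixS u j).1 (hfixS u' j).1 (hfixS u j).2 (hfixS u' j).2 }
  have hχ_apply : ∀ j (u : S), χ j u = normSign σ ((u.1 j : Kˣ) : K) := fun _ _ => rfl
  have hχH : ∀ j, H ≤ (χ j).ker := fun j n hn => by
    rw [MonoidHom.mem_ker, hχ_apply]
    rw [Subgroup.mem_subgroupOf] at hn
    have h1 := normSign_mul_eq_of_mem_map_unitNormMap σ hn 1 j
    rw [one_mul, normSign_one_eq] at h1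
    exact h1
  have hχχH : H ≤ (χ i * χ k).ker := fun n hn => by
    rw [MonoidHom.mem_ker, MonoidHom.mul_apply, show χ i n = 1 from hχH i hn, show χ k n = 1 from hχH k hn, mul_one]
  let ψ : Fin 3 → (S ⧸ H →* ℤ) := fun j => QuotientGroup.lift H (χ j) (hχH j)
  let ψ2 : S ⧸ H →* ℤ := QuotientGroup.lift H (χ i * χ k) hχχH
  have hψ_mk : ∀ j (u : S), ψ j (QuotientGroup.mk u) = normSign σ ((u.1 j : Kˣ) : K) := fun _ _ => rfl
  have hψ2_mk : ∀ u : S, ψ2 (QuotientGroup.mk u) = normSign σ ((u.1 i : Kˣ) : K) * normSign σ ((u.1 k : Kˣ) : K) := fun _ => rfl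
  -- pointwise: `2·classLabelSign (e q) = ω(D₁ i)·(ψ_i q + ε·ψ2 q)`
  have hpt : ∀ q : S ⧸ H, 2 * classLabelSign σ i (Λ M₀) (e q) = normSign σ (D₁ i) * (ψ i q + ε * ψ2 q) := by
    intro q
    induction q using QuotientGroup.induction_on with
    | H u =>
      rw [he_mk, hψ_mk, hψ2_mk]
      rw [show cl u = {D' : Fin 3 → K | ∃ n ∈ (unitStabilizer M₀).map (unitNormMap σ 3), ∀ j, D' j = D₁ j * ((u.1 j : Kˣ) : K) * ((n j : Kˣ) : K)}
        from rfl, classLabelSign_cl_eq hσc hc hdich hD₁ hNS Λ i k ε hΛ u.2]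
      exact two_mul_ite_eq hε (normSign_eq_one_or σ _) _ _
  -- the two character sums
  have hS1 : (∑ q : S ⧸ H, ψ i q) = if (∀ u ∈ fixedUnitStabilizer σ M₀, normSign σ ((u i : Kˣ) : K) = 1) then ((N'.relIndex S : ℕ) : ℤ) else 0 := by
    have hiff : ψ i = 1 ↔ ∀ u ∈ fixedUnitStabilizer σ M₀, normSign σ ((u i : Kˣ) : K) = 1 := by
      refine ⟨fun h u hu => ?_, fun h => ?_⟩
      · have := DFunLike.congr_fun h (QuotientGroup.mk ⟨u, hu⟩)
        rwa [hψ_mk, MonoidHom.one_apply] at this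
      · refine MonoidHom.ext fun q => ?_
        induction q using QuotientGroup.induction_on with
        | H u => rw [hψ_mk, MonoidHom.one_apply]; exact h u.1 u.2
    rw [sum_hom_units (ψ i), Nat.cast_ite, Nat.cast_zero]
    exact if_congr hiff hcard rfl
  have hS2 : (∑ q : S ⧸ H, ψ2 q) =
      if (∀ u ∈ fixedUnitStabilizer σ M₀, normSign σ ((u i : Kˣ) : K) * normSign σ ((u k : Kˣ) : K) = 1) then ((N'.relIndex S : ℕ) : ℤ) else 0 := by
    have hiff : ψ2 = 1 ↔ ∀ u ∈ fixedUnitStabilizer σ M₀, normSign σ ((u i : Kˣ) : K) * normSign σ ((u k : Kˣ) : K) = 1 := by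
      refine ⟨fun h u hu => ?_, fun h => ?_⟩
      · have := DFunLike.congr_fun h (QuotientGroup.mk ⟨u, hu⟩)
        rwa [hψ2_mk, MonoidHom.one_apply] at this
      · refine MonoidHom.ext fun q => ?_
        induction q using QuotientGroup.induction_on with
        | H u => rw [hψ2_mk, MonoidHom.one_apply]; exact h u.1 u.2
    rw [sum_hom_units ψ2, Nat.cast_ite, Nat.cast_zero]
    exact if_congr hiff hcard rfl
  -- assemble
  rw [hsum, Finset.mul_sum, Finset.sum_congr rfl fun q _ => hpt q, ← Finset.mul_sum, Finset.sum_add_distrib, ← Finset.mul_sum, hS1, hS2]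
  split_ifs <;> ring

open Classical in
/-- **HEAD A, UNIT NON-NORM FORM** (the scalar stabiliser `(c, c, c) ∈ S_F(M₀)` kills `[ω_i ≡ 1 on S_F]`):
`2 · labelledOddCount σ ϖ tv i Λ M₀ = ε · ω(D_{1,i}) · |A| · [∀ u ∈ S_F, ω(u_i)·ω(u_k) = 1]`; at `i = k` the indicator is `1` — «the same sign `ε·ω(D_{1,k})` for every such orbit».
[cite: Kottwitz1986BaseChangeUnits, §1 pp. 240–241] [cite: LanglandsShelstad1987, §3] -/
theorem two_mul_labelledOddCount_eq_of_oneSlot_of_unit (hσ : ∀ x, σ (σ x) = x)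
    {c : K} (hσc : σ c = c) (hcv : Valued.v c = 1) (hc : ¬ ∃ z : K, z * σ z = c)
    (hdich : ∀ x : K, σ x = x → x ≠ 0 → (∃ z : K, z * σ z = x) ∨ ∃ z : K, z * σ z = c * x)
    (hD₁ : ∀ j, σ (D₁ j) = D₁ j ∧ D₁ j ≠ 0) (hV₁ : IsVertexLattice σ ϖ (Matrix.diagonal D₁) tv M₀)
    (hcoset : ∀ D : Fin 3 → K, (∀ j, σ (D j) = D j ∧ D j ≠ 0) →
      (IsVertexLattice σ ϖ (Matrix.diagonal D) tv M₀ ↔ ∃ u ∈ fixedUnitStabilizer σ M₀, ∀ j, D j = D₁ j * ((u j : Kˣ) : K)))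
    (hA : ((unitStabilizer M₀).map (unitNormMap σ 3)).relIndex (fixedUnitStabilizer σ M₀) ≠ 0)
    (Λ : Submodule 𝒪[K] (Fin 3 → K) → (Fin 3 → K) → Prop) (i k : Fin 3) {ε : ℤ} (hε : ε = 1 ∨ ε = -1)
    (hΛ : ∀ u ∈ fixedUnitStabilizer σ M₀, Λ M₀ (fun j => D₁ j * ((u j : Kˣ) : K)) ↔ ε * normSign σ ((u k : Kˣ) : K) = 1) :
    2 * labelledOddCount σ ϖ tv i Λ M₀ =
      ε * normSign σ (D₁ i) * ((((unitStabilizer M₀).map (unitNormMap σ 3)).relIndex (fixedUnitStabilizer σ M₀) : ℕ) : ℤ) *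
        (if ∀ u ∈ fixedUnitStabilizer σ M₀, normSign σ ((u i : Kˣ) : K) * normSign σ ((u k : Kˣ) : K) = 1 then 1 else 0) := by
  rw [two_mul_labelledOddCount_eq_of_oneSlot hσ hσc hc hdich hD₁ hV₁ hcoset hA Λ i k hε hΛ, if_neg (not_forall_normSign_apply_eq_one σ M₀ hσc hcv hc i)]
  ring

open Classical in
/-- **HEAD A′ — THE PER-ORBIT TERM OF THE LABELLED STAGE A ON A ONE-SLOT ORBIT** (over `ℚ`, on a finite unit-torus orbit; `[𝒰 : N(S̃′)] = |A|·[𝒰 : S_F]` by the tower):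
`labelledOddCount σ ϖ tv i Λ M₀ ∕ [𝒰 : N(S̃′(M₀))] = ε·ω(D_{1,i})∕2 · [∀ u ∈ S_F, ω(u_i)·ω(u_k) = 1] · stabiliserWeight σ M₀` — HALF A κ-TERM for the pair `(i, k)`.
[cite: Kottwitz1986BaseChangeUnits, §1 pp. 240–241] [cite: LanglandsShelstad1987, §3] [cite: Rogawski1990, §4.9 Prop. 4.9.1 (a)(b) p. 55] -/
theorem labelledOddCount_div_relIndex_eq_of_oneSlot (hσ : ∀ x, σ (σ x) = x) (hvσ : ∀ a, Valued.v (σ a) = Valued.v a)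
    {c : K} (hσc : σ c = c) (hcv : Valued.v c = 1) (hc : ¬ ∃ z : K, z * σ z = c)
    (hdich : ∀ x : K, σ x = x → x ≠ 0 → (∃ z : K, z * σ z = x) ∨ ∃ z : K, z * σ z = c * x)
    (hfin : {M : Submodule 𝒪[K] (Fin 3 → K) | ∃ u ∈ unitTorus K 3, M = mapGL (diagGLUnits u) M₀}.Finite)
    (hD₁ : ∀ j, σ (D₁ j) = D₁ j ∧ D₁ j ≠ 0) (hV₁ : IsVertexLattice σ ϖ (Matrix.diagonal D₁) tv M₀)
    (hcoset : ∀ D : Fin 3 → K, (∀ j, σ (D j) = D j ∧ D j ≠ 0) →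
      (IsVertexLattice σ ϖ (Matrix.diagonal D) tv M₀ ↔ ∃ u ∈ fixedUnitStabilizer σ M₀, ∀ j, D j = D₁ j * ((u j : Kˣ) : K)))
    (Λ : Submodule 𝒪[K] (Fin 3 → K) → (Fin 3 → K) → Prop) (i k : Fin 3) {ε : ℤ} (hε : ε = 1 ∨ ε = -1)
    (hΛ : ∀ u ∈ fixedUnitStabilizer σ M₀, Λ M₀ (fun j => D₁ j * ((u j : Kˣ) : K)) ↔ ε * normSign σ ((u k : Kˣ) : K) = 1) :
    (labelledOddCount σ ϖ tv i Λ M₀ : ℚ) / ((((unitStabilizer M₀).map (unitNormMap σ 3)).relIndex (fixedUnitTorus σ 3) : ℕ) : ℚ) =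
      (ε : ℚ) * (normSign σ (D₁ i) : ℚ) / 2 *
        ((if ∀ u ∈ fixedUnitStabilizer σ M₀, normSign σ ((u i : Kˣ) : K) * normSign σ ((u k : Kˣ) : K) = 1 then 1 else 0 : ℤ) : ℚ) *
        stabiliserWeight σ M₀ := by
  classical
  set S := fixedUnitStabilizer σ M₀ with hSdef
  set N' := (unitStabilizer M₀).map (unitNormMap σ 3) with hN'def
  have hNS : N' ≤ S := map_unitNormMap_unitStabilizer_le σ hσ ϖ tv hD₁ hV₁ hcoset
  have hSU : S ≤ fixedUnitTorus σ 3 := inf_le_right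
  have hUN : N'.relIndex (fixedUnitTorus σ 3) ≠ 0 := relIndex_map_unitNormMap_unitStabilizer_ne_zero hσ hvσ hσc hcv hc hdich hfin
  have htower : N'.relIndex S * S.relIndex (fixedUnitTorus σ 3) = N'.relIndex (fixedUnitTorus σ 3) := Subgroup.relIndex_mul_relIndex N' S _ hNS hSU
  have hA : N'.relIndex S ≠ 0 := fun h => hUN (by rw [← htower, h, zero_mul])
  have hSF : S.relIndex (fixedUnitTorus σ 3) ≠ 0 := relIndex_fixedUnitStabilizer_ne_zero_of_finite σ hfin
  have h2 := two_mul_labelledOddCount_eq_of_oneSlot_of_unit hσ hσc hcv hc hdich hD₁ hV₁ hcoset hA Λ i k hε hΛ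
  have h2Q : (2 : ℚ) * (labelledOddCount σ ϖ tv i Λ M₀ : ℚ) = (ε : ℚ) * (normSign σ (D₁ i) : ℚ) * ((N'.relIndex S : ℕ) : ℚ) *
      ((if ∀ u ∈ fixedUnitStabilizer σ M₀, normSign σ ((u i : Kˣ) : K) * normSign σ ((u k : Kˣ) : K) = 1 then 1 else 0 : ℤ) : ℚ) := by
    exact_mod_cast h2
  have hA' : ((N'.relIndex S : ℕ) : ℚ) ≠ 0 := Nat.cast_ne_zero.2 hA
  have hSF' : ((S.relIndex (fixedUnitTorus σ 3) : ℕ) : ℚ) ≠ 0 := Nat.cast_ne_zero.2 hSF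
  have hL : (labelledOddCount σ ϖ tv i Λ M₀ : ℚ) = (ε : ℚ) * (normSign σ (D₁ i) : ℚ) * ((N'.relIndex S : ℕ) : ℚ) *
      ((if ∀ u ∈ fixedUnitStabilizer σ M₀, normSign σ ((u i : Kˣ) : K) * normSign σ ((u k : Kˣ) : K) = 1 then 1 else 0 : ℤ) : ℚ) / 2 := by
    linarith
  rw [hL, stabiliserWeight, ← hSdef, ← htower, Nat.cast_mul]
  field_simp

end HeadA

end Summit.HodgeConjecture.HodgeConjecture.Cruxes.H413.F0P3cDyRamLabelledOddOneSlotRead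

end
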